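import Summits.QuantumFields.YangMills.Theorems.UnitScaleTiltProp7CombTildTrueLin
import Literature.MathematicalPhysics.QuantumFieldTheory.Balaban1983to89.B7Prop3GeneralLinearBound
import HarnessLib

/-!
# Route `UnitScaleTilt`, crux K1 «MinimiserStabilityRegPr» (stmt-QuantumFields-19200), route-R E′ (A′)-on-Σ, P-A2 (β), row «(n3)-comb» —
# (O2) GROUNDWORK, file F-5a: THE ONE-STEP TRUE DERIVATIVE OF PRINT's SINGLE BAR SPLITS AS «FRAME GRADIENT + STRAIGHT MAIN TERM» UP TO `210·α·m`:
# `T_{V₀}(X)(c) = F̂_{V₀}X(c₋) − Ad_{V̄₀(c)}F̂_{V₀}X(c₊) + L·(Q₀X)_c + DEF`, `‖DEF‖ ≤ 210·α·m`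

«(O2) groundwork — not consumed by any displayed row before the freeze lifts» (★★OWNER `ym3-torus-plan` g29 RULINGS №20 (2), №22; «(II) GO» 06:26∕06:31Z).
Cell `ym3-torus`, D-0154 (3c) R3 twin-width seat `ym-routeR-w1` (gen 9); DESIGN memo `DESIGN-N3COMB-LINEAR-CORE-routeRw1g9.md` §1 row 1, file list §5 F-5.
THEOREMS ONLY (0 `def`, 0 `sorry`); `--supports stmt-QuantumFields-19200 --as helper`, count-neutral.  YM₃ on T³ is a ladder rung (R3), not the Clay problem; nothing here claims
`hMcomb`, `hMcomb₂`, (β), `hPA2`, `hcoS`, the stub, the crux, d = 4 or the mass gap.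

THE POINT.  In the structure recursion ✓`Prop7CornerCombStructure.cornerComb_structure` (F-4) the choice `CM_k := F̂_{Ū₀ᵏ}` — PRINT's frame exponent (112) read as a LINEAR
functional of the field, lit ✓`B7Prop3GeneralLinear.FhatCov L V₀ X y = Σ_r L⁻ᵈ·(R_{0,y}X)(Γ_{y,y+r})` (the cornered covariant comb mean of the (II) design) — makes the reduced step
`G_{k+1} = T_kG_k − ∇^{Ū₀ᵏ⁺¹}(F̂ G_k)` equal to PRINT's STRAIGHT MAIN TERM (125) `L·(Q₀G_k)_c` (lit ✓`Q0cov`) up to `[operator − 1]` defects of size `α·(walk mass)`.  This is the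
cornered twin of ✓`Prop7TrueLinReducedStep.norm_reduced_sub_line_le` (`159·α·m`), and the dressed form of ★routeR-w4's (S2) ∕ ★routeR-w6's PREREAD §0 (`Q_j = Q_j^{str} + d∘M_jλ_j`):
the algebra is lit ✓`B7Prop3GeneralLinearSplit.sum_Aloop_eq` ((115) summed: loop sums = `F̂(c₋) + L·Q₀ − ΣL⁻ᵈR(W_x)R(V₀(c))(tree at c₊) − ΣL⁻ᵈR(W_x)(segment)`), the analysis is the
engine of ✓`Prop7CombTildTrueLin` one order lower (`D eml(W₀) = mean + O(‖W₀ − 1‖)`: lit ✓`norm_fderiv_eml_sub_mean_le`; `κ₀ = eml W₀ = 1 + O(α)`: lit ✓`norm_eml_add_sub_eml_le` at `U = 1`;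
`R(W) − 1 = O(α)`: lit ✓`norm_conjR_sub_self_le`).

WHAT IS PROVED (ns `…Theorems.Prop7CombTrueStepSplit`; `𝔸` any C⋆-algebra; every `d`, `L ≥ 1`).
* §1 letters: `meanCLM_eq_sum_blockWeight` (`mean = Σ_r L⁻ᵈ•`), `norm_eml_sub_one_le_of_loops` (`‖κ₀ − 1‖ ≤ 12α`), `norm_sum_blockWeight_le`.
* §2 ★★ `norm_trueStep_sub_split_le` — the title, with the loop sums `Λ_r = (R_{0,q}X)(Γ_{c,x_r} ∪ (−c))`, the segment sum and the trees at `c₊` bounded in norm by `m`.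
* §3 ★ `norm_trueStep_sub_split_le_level` — read at level `k` of print's comb tower (`V₀ := Ū₀ᵏ`, `q := L•z`, `V̄₀(c) = Ū₀ᵏ⁺¹(z,κ)`): the `DEF_k` row of the design's table.
HONEST SCOPE.  One step, sup-type (walk-norm) defect with a displayed loop window `α ≤ 1∕24`; the `ℓ²` bookkeeping of `DEF` over a period cell (two-block masses) is F-5b.
Nothing of Bałaban's is asserted beyond the cited tree∕lit theorems.

References: T. Bałaban, CMP **98** (1985) 17–51 [Balaban1985Averaging] ((42) p.23, (58) p.27, (112)–(115) p.34, (119)–(120) p.35, (124)–(125) p.36); CMP **95** (1984) 17–40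
[Balaban1984PropagatorsI] ((1.18)–(1.20) pp.19–20); CMP **109** (1987) 249–301 [Balaban1987RG1] ((0.4)–(0.6) p.253).
-/

noncomputable section

open scoped BigOperators

namespace Summit.QuantumFields.YangMills.Theorems.Prop7CombTrueStepSplit

open NormedSpace
open Literature.MathematicalPhysics.QuantumFieldTheory.Balaban1983to89
open ExpMeanLog (eml)
open B7Prop1Explicit (Site Letter e hol seg treeWord boxVec gammaWord Wcx Xavg bavg expUnit U1 norm_inv_sub_one_le)
open B7Prop2Explicit (avgIter avgIter_succ rescale_apply unitaryUnits unitaryUnits_le_U1 hol_mem_of)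
open B7Eq78Linearization (conjR conjR_apply conjR_sub conjR_smul_real)
open B7Prop3GeneralRotated (tsum norm_conjR_le conjR_mul_left)
open B7Prop3GeneralLinear (FhatCov Q0cov)
open B7Prop3GeneralTild (Aloop)
open B7Prop3GeneralLinearSplit (sum_Aloop_eq sum_blockWeight conjR_sum)
open B7Prop3GeneralLinearBound (norm_conjR_sub_self_le)
open B7TransferAnalyticMean BlockAveragingEMLAnalyticMean
open Summit.QuantumFields.YangMills.Theorems.Prop7HolRatioPerStep (pi_norm_le_of_forall)
open Summit.QuantumFields.YangMills.Theorems.Prop7CombHolRatioPerStep (norm_coe_le_one_of_mem_U1 norm_coe_inv_le_one_of_mem_U1)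
open Summit.QuantumFields.YangMills.Theorems.Prop7CombTildTrueLin (coe_expUnit_Xavg_eq_eml expUnit_Xavg_eq expUnit_Xavg_mem_unitaryUnits norm_coe_Wcx_le_one)

variable {d : ℕ} {𝔸 : Type*} [CStarAlgebra 𝔸] [Nontrivial 𝔸]

/-! ## §1 Letters -/

omit [Nontrivial 𝔸] in
/-- The arithmetic mean over the corner box is print's `Σ_{x∈B(c₋)} L⁻ᵈ`: `mean f = Σ_r L⁻ᵈ • f r` (`card (Fin d → Fin L) = Lᵈ`). [cite: Balaban1985Averaging, (42) p.23] -/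
theorem meanCLM_eq_sum_blockWeight (L : ℕ) (f : (Fin d → Fin L) → 𝔸) :
    meanCLM (Fin d → Fin L) 𝔸 f = ∑ r : Fin d → Fin L, (((L : ℝ) ^ d)⁻¹) • f r := by
  rw [meanCLM_apply, Finset.smul_sum]
  refine Finset.sum_congr rfl fun r _ => ?_
  rw [Fintype.card_fun, Fintype.card_fin, Fintype.card_fin, ← Complex.coe_smul, Complex.ofReal_inv, Complex.ofReal_pow, Complex.ofReal_natCast, Nat.cast_pow]

omit [Nontrivial 𝔸] in
/-- A block-weighted sum of terms of norm `≤ b` has norm `≤ b` (`Σ_r L⁻ᵈ = 1`). [folklore] -/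
theorem norm_sum_blockWeight_le (L : ℕ) (hL : 1 ≤ L) (f : (Fin d → Fin L) → 𝔸) {b : ℝ} (hf : ∀ r, ‖f r‖ ≤ b) :
    ‖∑ r : Fin d → Fin L, (((L : ℝ) ^ d)⁻¹) • f r‖ ≤ b := by
  have hw : 0 ≤ ((L : ℝ) ^ d)⁻¹ := by positivity
  calc ‖∑ r : Fin d → Fin L, (((L : ℝ) ^ d)⁻¹) • f r‖ ≤ ∑ r : Fin d → Fin L, ‖(((L : ℝ) ^ d)⁻¹) • f r‖ := norm_sum_le _ _
    _ ≤ ∑ _r : Fin d → Fin L, ((L : ℝ) ^ d)⁻¹ * b := Finset.sum_le_sum fun r _ => by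
        rw [norm_smul, Real.norm_of_nonneg hw]; exact mul_le_mul_of_nonneg_left (hf r) hw
    _ = b := by
        rw [Finset.sum_const, Finset.card_univ, Fintype.card_fun, Fintype.card_fin, Fintype.card_fin, ← Nat.cast_smul_eq_nsmul ℝ,
          smul_eq_mul, Nat.cast_pow]
        have hL0 : ((L : ℝ) ^ d) ≠ 0 := by positivity
        field_simp

omit [Nontrivial 𝔸] in
/-- `‖κ₀ − 1‖ ≤ 12α`: the correction factor `κ₀ = exp X_c[V₀] = eml W₀` is `O(α)`-close to `1` when the block loops are (`eml 1 = 1`, lit ✓`norm_eml_add_sub_eml_le`).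
[cite: Balaban1985Averaging, (42) p.23; Balaban1987RG1, (0.8) p.253] -/
theorem norm_eml_sub_one_le_of_loops (L : ℕ) (V₀ : Site d → Fin d → 𝔸ˣ) (q : Site d) (κ : Fin d) {α : ℝ}
    (hα : ∀ r : Fin d → Fin L, ‖((Wcx L V₀ q κ (boxVec L r) : 𝔸ˣ) : 𝔸) - 1‖ ≤ α) (hα24 : α ≤ 1 / 24) (hα0 : 0 ≤ α) :
    ‖((expUnit (Xavg L V₀ q κ) : 𝔸ˣ) : 𝔸) - 1‖ ≤ 12 * α := by
  set W₀ : (Fin d → Fin L) → 𝔸 := fun r => ((Wcx L V₀ q κ (boxVec L r) : 𝔸ˣ) : 𝔸) with hW₀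
  have hsup : ‖W₀ - 1‖ ≤ α := pi_norm_le_of_forall hα0 fun r => hα r
  have h1 : ‖(1 : (Fin d → Fin L) → 𝔸) - 1‖ ≤ 1 / 6 := by simp
  have h := norm_eml_add_sub_eml_le (U := (1 : (Fin d → Fin L) → 𝔸)) (V := W₀ - 1) h1 (hsup.trans hα24)
  rw [add_sub_cancel, eml_one] at h
  rw [coe_expUnit_Xavg_eq_eml]
  exact h.trans (by linarith)

/-! ## §2 ★★ The one-step true derivative splits as «frame gradient + straight main term» -/

/-- ★★ **`T_{V₀}(X)(c) = F̂X(c₋) − Ad_{V̄₀(c)}F̂X(c₊) + L·(Q₀X)_c + DEF`, `‖DEF‖ ≤ 210·α·m`.**  Background `V₀` unitary-valued, block loops `W₀,r` within `α ≤ 1∕24` of `1`;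
`m` bounds the norms of the loop sums `Λ_r = (R_{0,q}X)(Γ_{c,x_r} ∪ (−c))`, of the segment sum `Λ_S = (R_{0,q}X)([c₋,c₊])` and of the trees `(R_{0,c₊}X)(Γ_{c₊,c₊+r})` at `c₊`.  Then the
one-step operator of ✓`norm_tild_sub_one_sub_trueLin_le` differs from `FhatCov L V₀ X q − Ad_{bavg L V₀ q κ}(FhatCov L V₀ X (q + L•e_κ)) + L•Q0cov L V₀ X q κ` by at most
`210·α·m`: `D eml(W₀) − mean` (144), `Λ_r(W₀,r − 1)` (1), `κ₀⁻¹ − 1` (12), `Ad_{κ₀} − 1` on the segment (24), `[R(W_r) − 1]` on the segment (2) and `[R(W_r) − R(κ₀)]` on the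
transported trees (26) — over lit ✓`sum_Aloop_eq` ((115) summed). The cornered twin of ✓`Prop7TrueLinReducedStep.norm_reduced_sub_line_le`. «(O2) groundwork.»
[cite: Balaban1985Averaging, (112)-(115) p.34, (119)-(120) p.35, (124)-(125) p.36] -/
theorem norm_trueStep_sub_split_le (L : ℕ) (hL : 1 ≤ L) (V₀ : Site d → Fin d → 𝔸ˣ) (hV₀ : ∀ x μ, V₀ x μ ∈ unitaryUnits 𝔸)
    (X : Site d → Fin d → 𝔸) (q : Site d) (κ : Fin d) {m α : ℝ} (hm : 0 ≤ m)
    (hΛ : ∀ r : Fin d → Fin L, ‖tsum V₀ X q (gammaWord L κ (boxVec L r) ++ seg κ (-(L : ℤ)))‖ ≤ m)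
    (hS : ‖tsum V₀ X q (seg κ (L : ℤ))‖ ≤ m)
    (hT : ∀ r : Fin d → Fin L, ‖tsum V₀ X (q + (L : ℤ) • e κ) (treeWord (boxVec L r))‖ ≤ m)
    (hα : ∀ r : Fin d → Fin L, ‖((Wcx L V₀ q κ (boxVec L r) : 𝔸ˣ) : 𝔸) - 1‖ ≤ α) (hα24 : α ≤ 1 / 24) :
    ‖fderiv ℂ (eml : ((Fin d → Fin L) → 𝔸) → 𝔸) (fun r => ((Wcx L V₀ q κ (boxVec L r) : 𝔸ˣ) : 𝔸))
          (fun r => tsum V₀ X q (gammaWord L κ (boxVec L r) ++ seg κ (-(L : ℤ))) * ((Wcx L V₀ q κ (boxVec L r) : 𝔸ˣ) : 𝔸))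
          * (((expUnit (Xavg L V₀ q κ))⁻¹ : 𝔸ˣ) : 𝔸)
        + ((expUnit (Xavg L V₀ q κ) : 𝔸ˣ) : 𝔸) * tsum V₀ X q (seg κ (L : ℤ)) * (((expUnit (Xavg L V₀ q κ))⁻¹ : 𝔸ˣ) : 𝔸)
        - (FhatCov L V₀ X q - conjR (bavg L V₀ q κ) (FhatCov L V₀ X (q + (L : ℤ) • e κ)) + (L : ℝ) • Q0cov L V₀ X q κ)‖
      ≤ 210 * α * m := by
  -- letters
  have hα0 : 0 ≤ α := (norm_nonneg _).trans (hα (fun _ => ⟨0, hL⟩))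
  have hV₀' : ∀ x μ, V₀ x μ ∈ U1 𝔸 := fun x μ => unitaryUnits_le_U1 (hV₀ x μ)
  set W₀ : (Fin d → Fin L) → 𝔸 := fun r => ((Wcx L V₀ q κ (boxVec L r) : 𝔸ˣ) : 𝔸) with hW₀
  set Λ : (Fin d → Fin L) → 𝔸 := fun r => tsum V₀ X q (gammaWord L κ (boxVec L r) ++ seg κ (-(L : ℤ))) with hΛ'
  set Vl : (Fin d → Fin L) → 𝔸 := fun r => Λ r * W₀ r with hVl
  set κ₀u : 𝔸ˣ := expUnit (Xavg L V₀ q κ) with hκ₀u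
  set S₀u : 𝔸ˣ := hol V₀ q (seg κ (L : ℤ)) with hS₀u
  set ΛS : 𝔸 := tsum V₀ X q (seg κ (L : ℤ)) with hΛS
  set D : 𝔸 := fderiv ℂ (eml : ((Fin d → Fin L) → 𝔸) → 𝔸) W₀ Vl with hD
  set mΛ : 𝔸 := ∑ r : Fin d → Fin L, (((L : ℝ) ^ d)⁻¹) • Λ r with hmΛ
  -- unitarity letters
  have hW₀n : ∀ r, ‖W₀ r‖ ≤ 1 := fun r => norm_coe_Wcx_le_one L hV₀ q κ _
  have hWU1 : ∀ r : Fin d → Fin L, Wcx L V₀ q κ (boxVec L r) ∈ U1 𝔸 := fun r => by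
    unfold Wcx; exact unitaryUnits_le_U1 ((unitaryUnits 𝔸).mul_mem (hol_mem_of hV₀ _ _) ((unitaryUnits 𝔸).inv_mem (hol_mem_of hV₀ _ _)))
  have hwin : ∀ r : Fin d → Fin L, ‖((Wcx L V₀ q κ (boxVec L r) : 𝔸ˣ) : 𝔸) - 1‖ ≤ 1 / 4 := fun r => (hα r).trans (hα24.trans (by norm_num))
  have hκU : κ₀u ∈ unitaryUnits 𝔸 := expUnit_Xavg_mem_unitaryUnits L hV₀ q κ hwin
  have hκU1 : κ₀u ∈ U1 𝔸 := unitaryUnits_le_U1 hκU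
  have hSU1 : S₀u ∈ U1 𝔸 := unitaryUnits_le_U1 (hol_mem_of hV₀ _ _)
  have hκn : ‖(κ₀u : 𝔸)‖ ≤ 1 := norm_coe_le_one_of_mem_U1 hκU1
  have hκin : ‖((κ₀u⁻¹ : 𝔸ˣ) : 𝔸)‖ ≤ 1 := norm_coe_inv_le_one_of_mem_U1 hκU1
  have hκ1 : ‖(κ₀u : 𝔸) - 1‖ ≤ 12 * α := norm_eml_sub_one_le_of_loops L V₀ q κ hα hα24 hα0
  have hκi1 : ‖((κ₀u⁻¹ : 𝔸ˣ) : 𝔸) - 1‖ ≤ 12 * α := (norm_inv_sub_one_le hκU1).trans hκ1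
  -- (a)+(b): `D` against the mean of the loop sums
  have hW₀sup : ‖W₀ - 1‖ ≤ 1 / 24 := pi_norm_le_of_forall (by norm_num) fun r => (hα r).trans hα24
  have hW₀supα : ‖W₀ - 1‖ ≤ α := pi_norm_le_of_forall hα0 fun r => hα r
  have hVlsup : ‖Vl‖ ≤ m := pi_norm_le_of_forall hm fun r => by
    simp only [hVl]
    exact (norm_mul_le _ _).trans ((mul_le_mul (hΛ r) (hW₀n r) (norm_nonneg _) hm).trans (by rw [mul_one]))
  have hDa : ‖D - meanCLM (Fin d → Fin L) 𝔸 Vl‖ ≤ 144 * α * m := by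
    refine (norm_fderiv_eml_sub_mean_le hW₀sup Vl).trans ?_
    calc 144 * ‖Vl‖ * ‖W₀ - 1‖ ≤ 144 * m * α := by gcongr
      _ = 144 * α * m := by ring
  have hDb : ‖meanCLM (Fin d → Fin L) 𝔸 Vl - mΛ‖ ≤ α * m := by
    rw [meanCLM_eq_sum_blockWeight, hmΛ, ← Finset.sum_sub_distrib]
    refine norm_sum_blockWeight_le L hL (fun r => Vl r - Λ r) (fun r => ?_) |>.trans_eq' ?_
    · simp only [hVl]
      have hE3 : Λ r * W₀ r - Λ r = Λ r * (W₀ r - 1) := by noncomm_ring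
      rw [hE3]
      calc ‖Λ r * (W₀ r - 1)‖ ≤ ‖Λ r‖ * ‖W₀ r - 1‖ := norm_mul_le _ _
        _ ≤ m * α := mul_le_mul (hΛ r) (hα r) (norm_nonneg _) hm
        _ = α * m := mul_comm _ _
    · refine congrArg _ (Finset.sum_congr rfl fun r _ => ?_); rw [smul_sub]
  have hmΛn : ‖mΛ‖ ≤ m := norm_sum_blockWeight_le L hL Λ hΛ
  -- (c): `D·κ₀⁻¹ − mΛ`
  have hC : ‖D * ((κ₀u⁻¹ : 𝔸ˣ) : 𝔸) - mΛ‖ ≤ 157 * α * m := by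
    have hE : D * ((κ₀u⁻¹ : 𝔸ˣ) : 𝔸) - mΛ = (D - mΛ) * ((κ₀u⁻¹ : 𝔸ˣ) : 𝔸) + mΛ * (((κ₀u⁻¹ : 𝔸ˣ) : 𝔸) - 1) := by noncomm_ring
    have hDm : ‖D - mΛ‖ ≤ 145 * α * m := by
      have hE2 : D - mΛ = (D - meanCLM (Fin d → Fin L) 𝔸 Vl) + (meanCLM (Fin d → Fin L) 𝔸 Vl - mΛ) := by abel
      rw [hE2]; exact (norm_add_le _ _).trans (by linarith)
    rw [hE]
    calc ‖(D - mΛ) * ((κ₀u⁻¹ : 𝔸ˣ) : 𝔸) + mΛ * (((κ₀u⁻¹ : 𝔸ˣ) : 𝔸) - 1)‖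
        ≤ ‖D - mΛ‖ * ‖((κ₀u⁻¹ : 𝔸ˣ) : 𝔸)‖ + ‖mΛ‖ * ‖((κ₀u⁻¹ : 𝔸ˣ) : 𝔸) - 1‖ :=
          (norm_add_le _ _).trans (add_le_add (norm_mul_le _ _) (norm_mul_le _ _))
      _ ≤ 145 * α * m * 1 + m * (12 * α) := by gcongr
      _ = 157 * α * m := by ring
  -- (d): `κ₀ Λ_S κ₀⁻¹ − Λ_S`
  have hDseg : ‖(κ₀u : 𝔸) * ΛS * ((κ₀u⁻¹ : 𝔸ˣ) : 𝔸) - ΛS‖ ≤ 24 * α * m := by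
    have h := norm_conjR_sub_self_le hκU1 hκ1 ΛS
    rw [conjR_apply] at h
    exact h.trans (by nlinarith [hS, hα0])
  -- (e): (115) summed — the loop sums are `F̂(c₋) + L·Q₀ − Σ R(W_r)R(V₀(c))(tree at c₊) − Σ R(W_r)(segment)`
  have hsplit : mΛ = FhatCov L V₀ X q + (L : ℝ) • Q0cov L V₀ X q κ
        - ∑ r : Fin d → Fin L, (((L : ℝ) ^ d)⁻¹) • conjR (Wcx L V₀ q κ (boxVec L r))
            (conjR (hol V₀ q (seg κ L)) (tsum V₀ X (q + (L : ℤ) • e κ) (treeWord (boxVec L r))))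
        - ∑ r : Fin d → Fin L, (((L : ℝ) ^ d)⁻¹) • conjR (Wcx L V₀ q κ (boxVec L r)) (tsum V₀ X q (seg κ L)) := by
    rw [hmΛ]; exact sum_Aloop_eq L hL V₀ X q κ
  -- (f): the segment pieces `Σ L⁻ᵈ R(W_r)Λ_S` against `Λ_S`
  have hF : ‖ΛS - ∑ r : Fin d → Fin L, (((L : ℝ) ^ d)⁻¹) • conjR (Wcx L V₀ q κ (boxVec L r)) (tsum V₀ X q (seg κ L))‖ ≤ 2 * α * m := by
    have hE : ΛS - ∑ r : Fin d → Fin L, (((L : ℝ) ^ d)⁻¹) • conjR (Wcx L V₀ q κ (boxVec L r)) (tsum V₀ X q (seg κ L))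
        = ∑ r : Fin d → Fin L, (((L : ℝ) ^ d)⁻¹) • (ΛS - conjR (Wcx L V₀ q κ (boxVec L r)) ΛS) := by
      rw [← sum_blockWeight L hL ΛS, ← Finset.sum_sub_distrib, sum_blockWeight L hL ΛS]
      exact Finset.sum_congr rfl fun r _ => by rw [smul_sub]
    rw [hE]
    refine norm_sum_blockWeight_le L hL _ fun r => ?_
    rw [norm_sub_rev]
    exact (norm_conjR_sub_self_le (hWU1 r) (hα r) ΛS).trans (by nlinarith [hS, hα0])
  -- (g): the transported trees `Σ L⁻ᵈ R(W_r)R(V₀(c))(tree)` against `Ad_{V̄₀(c)} F̂(c₊)`, `V̄₀(c) = κ₀·V₀(c)`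
  have hG : ‖conjR (bavg L V₀ q κ) (FhatCov L V₀ X (q + (L : ℤ) • e κ))
        - ∑ r : Fin d → Fin L, (((L : ℝ) ^ d)⁻¹) • conjR (Wcx L V₀ q κ (boxVec L r))
            (conjR (hol V₀ q (seg κ L)) (tsum V₀ X (q + (L : ℤ) • e κ) (treeWord (boxVec L r))))‖ ≤ 26 * α * m := by
    have hbavg : bavg L V₀ q κ = κ₀u * S₀u := by rw [hκ₀u, hS₀u, bavg]
    have hE : conjR (bavg L V₀ q κ) (FhatCov L V₀ X (q + (L : ℤ) • e κ))
        - ∑ r : Fin d → Fin L, (((L : ℝ) ^ d)⁻¹) • conjR (Wcx L V₀ q κ (boxVec L r))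
            (conjR (hol V₀ q (seg κ L)) (tsum V₀ X (q + (L : ℤ) • e κ) (treeWord (boxVec L r))))
        = ∑ r : Fin d → Fin L, (((L : ℝ) ^ d)⁻¹) •
            (conjR κ₀u (conjR S₀u (tsum V₀ X (q + (L : ℤ) • e κ) (treeWord (boxVec L r))))
              - conjR (Wcx L V₀ q κ (boxVec L r)) (conjR S₀u (tsum V₀ X (q + (L : ℤ) • e κ) (treeWord (boxVec L r))))) := by
      rw [hbavg, FhatCov, conjR_sum, ← Finset.sum_sub_distrib]
      refine Finset.sum_congr rfl fun r _ => ?_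
      rw [conjR_smul_real, conjR_mul_left, smul_sub, hS₀u]
    rw [hE]
    refine norm_sum_blockWeight_le L hL _ fun r => ?_
    set Z : 𝔸 := conjR S₀u (tsum V₀ X (q + (L : ℤ) • e κ) (treeWord (boxVec L r))) with hZ
    have hZn : ‖Z‖ ≤ m := (norm_conjR_le hSU1 _).trans (hT r)
    have hE2 : conjR κ₀u Z - conjR (Wcx L V₀ q κ (boxVec L r)) Z = (conjR κ₀u Z - Z) - (conjR (Wcx L V₀ q κ (boxVec L r)) Z - Z) := by abel
    rw [hE2]
    calc ‖(conjR κ₀u Z - Z) - (conjR (Wcx L V₀ q κ (boxVec L r)) Z - Z)‖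
        ≤ ‖conjR κ₀u Z - Z‖ + ‖conjR (Wcx L V₀ q κ (boxVec L r)) Z - Z‖ := norm_sub_le _ _
      _ ≤ 2 * (12 * α) * ‖Z‖ + 2 * α * ‖Z‖ := add_le_add (norm_conjR_sub_self_le hκU1 hκ1 Z) (norm_conjR_sub_self_le (hWU1 r) (hα r) Z)
      _ ≤ 26 * α * m := by nlinarith [hZn, hα0, norm_nonneg Z]
  -- assembly: `T − (F̂ − Ad F̂′ + L·Q₀) = (Dκ₀⁻¹ − mΛ) + (κ₀Λ_Sκ₀⁻¹ − Λ_S) + (Λ_S − Σ R(W)Λ_S) + (Ad F̂′ − Σ R(W)R(V₀(c))tree)`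
  have hE : D * ((κ₀u⁻¹ : 𝔸ˣ) : 𝔸) + (κ₀u : 𝔸) * ΛS * ((κ₀u⁻¹ : 𝔸ˣ) : 𝔸)
        - (FhatCov L V₀ X q - conjR (bavg L V₀ q κ) (FhatCov L V₀ X (q + (L : ℤ) • e κ)) + (L : ℝ) • Q0cov L V₀ X q κ)
      = (D * ((κ₀u⁻¹ : 𝔸ˣ) : 𝔸) - mΛ) + ((κ₀u : 𝔸) * ΛS * ((κ₀u⁻¹ : 𝔸ˣ) : 𝔸) - ΛS)
        + (ΛS - ∑ r : Fin d → Fin L, (((L : ℝ) ^ d)⁻¹) • conjR (Wcx L V₀ q κ (boxVec L r)) (tsum V₀ X q (seg κ L)))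
        + (conjR (bavg L V₀ q κ) (FhatCov L V₀ X (q + (L : ℤ) • e κ))
            - ∑ r : Fin d → Fin L, (((L : ℝ) ^ d)⁻¹) • conjR (Wcx L V₀ q κ (boxVec L r))
                (conjR (hol V₀ q (seg κ L)) (tsum V₀ X (q + (L : ℤ) • e κ) (treeWord (boxVec L r))))) := by
    rw [hsplit]; abel
  rw [hE]
  calc _ ≤ ‖D * ((κ₀u⁻¹ : 𝔸ˣ) : 𝔸) - mΛ‖ + ‖(κ₀u : 𝔸) * ΛS * ((κ₀u⁻¹ : 𝔸ˣ) : 𝔸) - ΛS‖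
          + ‖ΛS - ∑ r : Fin d → Fin L, (((L : ℝ) ^ d)⁻¹) • conjR (Wcx L V₀ q κ (boxVec L r)) (tsum V₀ X q (seg κ L))‖
          + ‖conjR (bavg L V₀ q κ) (FhatCov L V₀ X (q + (L : ℤ) • e κ))
              - ∑ r : Fin d → Fin L, (((L : ℝ) ^ d)⁻¹) • conjR (Wcx L V₀ q κ (boxVec L r))
                  (conjR (hol V₀ q (seg κ L)) (tsum V₀ X (q + (L : ℤ) • e κ) (treeWord (boxVec L r))))‖ :=
        (norm_add_le _ _).trans (add_le_add ((norm_add_le _ _).trans (add_le_add (norm_add_le _ _) le_rfl)) le_rfl)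
    _ ≤ 157 * α * m + 24 * α * m + 2 * α * m + 26 * α * m := add_le_add (add_le_add (add_le_add hC hDseg) hF) hG
    _ ≤ 210 * α * m := by nlinarith [hα0, hm]

/-! ## §3 ★ The same at level `k` of print's comb tower -/

/-- ★ **THE `DEF_k` ROW OF THE (II) DESIGN**: at level `k` (`V₀ := Ū₀ᵏ = avgIter L U₀ k`, corner `q = L•z`, coarse bond `Ū₀ᵏ⁺¹(z,κ) = bavg L Ū₀ᵏ (L•z) κ` by lit ✓`avgIter_succ`):
`‖T_k(X)(z,κ) − (F̂_{Ū₀ᵏ}X(L•z) − Ad_{Ū₀ᵏ⁺¹(z,κ)}F̂_{Ū₀ᵏ}X(L•z + L•e_κ) + L·(Q₀X)(L•z,κ))‖ ≤ 210·α_k·m` — i.e. with `CM_k X z := FhatCov L (avgIter L U₀ k) X (L•z)` in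
✓`Prop7CornerCombStructure.cornerComb_structure`, the reduced step is the straight main term up to `210·α_k·m`. «(O2) groundwork.» [cite: Balaban1985Averaging, (43) p.24, (112)-(115) p.34, (124)-(125) p.36] -/
theorem norm_trueStep_sub_split_le_level (L : ℕ) (hL : 1 ≤ L) (U₀ : Site d → Fin d → 𝔸ˣ) (k : ℕ) (hV₀ : ∀ x μ, avgIter L U₀ k x μ ∈ unitaryUnits 𝔸)
    (X : Site d → Fin d → 𝔸) (z : Site d) (κ : Fin d) {m α : ℝ} (hm : 0 ≤ m)
    (hΛ : ∀ r : Fin d → Fin L, ‖tsum (avgIter L U₀ k) X ((L : ℤ) • z) (gammaWord L κ (boxVec L r) ++ seg κ (-(L : ℤ)))‖ ≤ m)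
    (hS : ‖tsum (avgIter L U₀ k) X ((L : ℤ) • z) (seg κ (L : ℤ))‖ ≤ m)
    (hT : ∀ r : Fin d → Fin L, ‖tsum (avgIter L U₀ k) X ((L : ℤ) • z + (L : ℤ) • e κ) (treeWord (boxVec L r))‖ ≤ m)
    (hα : ∀ r : Fin d → Fin L, ‖((Wcx L (avgIter L U₀ k) ((L : ℤ) • z) κ (boxVec L r) : 𝔸ˣ) : 𝔸) - 1‖ ≤ α) (hα24 : α ≤ 1 / 24) :
    ‖fderiv ℂ (eml : ((Fin d → Fin L) → 𝔸) → 𝔸) (fun r => ((Wcx L (avgIter L U₀ k) ((L : ℤ) • z) κ (boxVec L r) : 𝔸ˣ) : 𝔸))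
          (fun r => tsum (avgIter L U₀ k) X ((L : ℤ) • z) (gammaWord L κ (boxVec L r) ++ seg κ (-(L : ℤ)))
            * ((Wcx L (avgIter L U₀ k) ((L : ℤ) • z) κ (boxVec L r) : 𝔸ˣ) : 𝔸))
          * (((expUnit (Xavg L (avgIter L U₀ k) ((L : ℤ) • z) κ))⁻¹ : 𝔸ˣ) : 𝔸)
        + ((expUnit (Xavg L (avgIter L U₀ k) ((L : ℤ) • z) κ) : 𝔸ˣ) : 𝔸) * tsum (avgIter L U₀ k) X ((L : ℤ) • z) (seg κ (L : ℤ))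
          * (((expUnit (Xavg L (avgIter L U₀ k) ((L : ℤ) • z) κ))⁻¹ : 𝔸ˣ) : 𝔸)
        - (FhatCov L (avgIter L U₀ k) X ((L : ℤ) • z) - conjR (avgIter L U₀ (k + 1) z κ) (FhatCov L (avgIter L U₀ k) X ((L : ℤ) • z + (L : ℤ) • e κ))
            + (L : ℝ) • Q0cov L (avgIter L U₀ k) X ((L : ℤ) • z) κ)‖
      ≤ 210 * α * m := by
  rw [avgIter_succ, rescale_apply]
  exact norm_trueStep_sub_split_le L hL (avgIter L U₀ k) hV₀ X ((L : ℤ) • z) κ hm hΛ hS hT hα hα24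

end Summit.QuantumFields.YangMills.Theorems.Prop7CombTrueStepSplit

end
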